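import Summits.CriticalPhenomena.PercolationContinuityZ3.Theorems.Transplant.FKDoubleFanCrossFar
import HarnessLib

/-!
# Double fans `K₂ ∨ P_{m+1}`, far cross-apex pairs with a TWO-SIDED middle: the planar monoid `⟨detach, P_a, P_b⟩`,
# the 14-dimensional STRIP VECTOR, and the reduction of the middle word to it at EVERY distance

Helper file (`--supports stmt-CriticalPhenomena-4575`), FK sub-lane `prim-bschramm-fk-3` (gen 34); builds on p205010 (kernel theorem, internal
audit signed; external expert review pending).  Pure real algebra, no sorries; standard axioms.  Memo `bschramm/prim-bschramm-fk-3/FAR-CROSS-IX.md`.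

Setting of `…DoubleFanCrossFar`: the pair `(a c_j, b c_k)`, pinned partition functions `crossFarZ q mids rd u s σ τ`, middle blocks
`(r_i, x_i, y_i)` acting by `midWord` (`rimStep r`, then `BC_y ∗ ·`, then `AC_x ∗ ·`).  `…DoubleFanOneSided` treated the ONE-SIDED middles
(`y_i = 0`): there the middle word lies in the 5-dimensional fan algebra `⟨id, P_a, detach⟩`.  This file treats ARBITRARY middles.
Since `E_r = r·id + (1−r)·detach`, `AC_x ∗ · = (1−x)·id + x·P_a`, `BC_y ∗ · = (1−y)·id + y·P_b` (`P_a = AC_1 ∗ ·`, `P_b = BC_1 ∗ ·`), every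
middle word is a non-negative combination of words in the three operators `D = detach`, `A = P_a`, `B = P_b`.  Modulo the scalars `q^k`
these words have exactly FOURTEEN normal forms `I, A, B, AB, D, DA, AD, DB, BD, ADB, BDA, BAD, DBA, DBAD` (relations `A² = A`, `B² = B`,
`AB = BA`, `D² = qD`, `DAD = DBD = D`, `ADA = A`, `BDB = B`, `ABD·A = AB`, …) — in bijection with the 14 NONCROSSING partitions of the four
terminals `(c_j, a, c, b)` of the strip (the coefficient of `W_m` in the expansion of the middle word IS the mass of the corresponding planar
boundary partition of the strip, internal clusters weighted by `q`; e.g. `D ↔ c_j|a|b|c`, `I ↔ {c_j c}|a|b`, `DBAD ↔ {a b}|c_j|c`; memo §1).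
Main content (all identities by `ring` on the five fibre coordinates):
* `S14` (the strip vector), `stripCombo q c X = Σ_m c_m · W_m X`, the coefficient updates `S14.stepE` (rim step), `S14.stepA` (`a`-spoke),
  `S14.stepB` (`b`-spoke) = the left multiplication tables of `D, A, B` on the 14 normal forms, and the commutation identities
  **`rimStep_stripCombo`**, **`conv_edgeAC_stripCombo`**, **`conv_edgeBC_stripCombo`**;
* **`midWord_stripCombo`** / **`midWord_eq_stripCombo`**: `midWord q mids X = stripCombo q (stripVec q mids 1) X` — the middle word of ANY
  length is the strip combination of its recursively computed strip vector (`stripVec`), whose entries are `≥ 0` (`stripVec_nonneg`);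
* **`stripCombo_kerVec`**: the one linear relation among the 14 operators,
  `p(1+p)·I − p²(A + B) + q²·AB + p(D − DA − AD − DB − BD + ADB + BDA) − q(BAD + DBA) + DBAD = 0` (`p = 1 − q`) — they span the
  13-dimensional block algebra `End(V₃) ⊕ End(V₂)` of `…DoubleFanSectorNC`;
* **`stripCombo_delta0`**: the "forget `c_j`" reduction `Σ_m c_m W_m δ₀` in closed form (an `InKE` vector whenever `c` is a strip vector:
  **`isStripVec_forget_inKE`**);
* **`crossFarZ_eq_stripZ`** and **`negCorr_spokes_cross_far_of_strip`**: the four pinned partition functions are the valuations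
  `stripZ q c u s σ τ = val_q(s ∗ BC_τ ∗ Σ_m c_m W_m (AC_σ ∗ u))`, LINEAR in the strip vector `c`, so cross-apex negative correlation at every
  distance follows from the single finite-dimensional statement "the quadratic form `c ↦ stripZ¹⁰stripZ⁰¹ − stripZ¹¹stripZ⁰⁰` is `≥ 0` on strip
  vectors, for all `u, s ∈ InKE q`" (`IsStripVec`).  Memo §2–§4: strip vectors form a 13-dimensional variety cut out by one cubic
  (`(1+p)·det[[D,DA,DB],[AD,A,ADB],[BD,BDA,B]] + I·L = 0`), and the ten three-terminal reductions of a strip vector satisfy `Valid ∧ U`.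
[cite: Grimmett2006, §3.9 eq. (3.94) (pp. 63–64)] [folklore]
-/

noncomputable section

namespace Summit.CriticalPhenomena.PercolationContinuityZ3.Theorems

namespace FK

namespace ThreeApex

/-! ### The two pinned-spoke operators -/

/-- `P_a X = AC_1 ∗ X` (join `a` and the moving rim vertex). [folklore] -/
def opA (X : V5) : V5 := conv (edgeAC 1) X

/-- `P_b X = BC_1 ∗ X` (join `b` and the moving rim vertex). [folklore] -/
def opB (X : V5) : V5 := conv (edgeBC 1) X

/-! ### The strip vector and the strip combination -/

/-- A vector indexed by the 14 NONCROSSING partitions of the four terminals `(c_j, a, c, b)` of a double-fan strip (cyclic order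
`c_j, a, c, b`; the crossing partition `{c_j c}|{a b}` is absent), named by the normal forms of the planar monoid `⟨D, A, B⟩`
(`D = detach`, `A = P_a`, `B = P_b`): `I` ↔ `{c_j c}|a|b`, `A` ↔ `{c_j a c}|b`, `B` ↔ `{c_j b c}|a`, `AB` ↔ `{c_j a b c}`, `D` ↔ `c_j|a|b|c`, `DA` ↔ `{c_j a}|b|c`, `AD` ↔ `{a c}|c_j|b`, `DB` ↔ `{c_j b}|a|c`, `BD` ↔ `{b c}|c_j|a`, `ADB` ↔ `{c_j b}|{a c}`, `BDA` ↔ `{c_j a}|{b c}`, `BAD` ↔ `{a b c}|c_j`, `DBA` ↔ `{c_j a b}|c`, `DBAD` ↔ `{a b}|c_j|c`. [folklore] -/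
@[ext] structure S14 where
  /-- coefficient of `W_{I}` (partition `{c_j c}|a|b`) -/
  cI : ℝ
  /-- coefficient of `W_{A}` (partition `{c_j a c}|b`) -/
  cA : ℝ
  /-- coefficient of `W_{B}` (partition `{c_j b c}|a`) -/
  cB : ℝ
  /-- coefficient of `W_{AB}` (partition `{c_j a b c}`) -/
  cAB : ℝ
  /-- coefficient of `W_{D}` (partition `c_j|a|b|c`) -/
  cD : ℝ
  /-- coefficient of `W_{DA}` (partition `{c_j a}|b|c`) -/
  cDA : ℝ
  /-- coefficient of `W_{AD}` (partition `{a c}|c_j|b`) -/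
  cAD : ℝ
  /-- coefficient of `W_{DB}` (partition `{c_j b}|a|c`) -/
  cDB : ℝ
  /-- coefficient of `W_{BD}` (partition `{b c}|c_j|a`) -/
  cBD : ℝ
  /-- coefficient of `W_{ADB}` (partition `{c_j b}|{a c}`) -/
  cADB : ℝ
  /-- coefficient of `W_{BDA}` (partition `{c_j a}|{b c}`) -/
  cBDA : ℝ
  /-- coefficient of `W_{BAD}` (partition `{a b c}|c_j`) -/
  cBAD : ℝ
  /-- coefficient of `W_{DBA}` (partition `{c_j a b}|c`) -/
  cDBA : ℝ
  /-- coefficient of `W_{DBAD}` (partition `{a b}|c_j|c`) -/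
  cDBAD : ℝ

namespace S14

/-- All fourteen coefficients are non-negative. [folklore] -/
structure Nonneg (c : S14) : Prop where
  /-- `0 ≤ c_{I}` -/
  hI : 0 ≤ c.cI
  /-- `0 ≤ c_{A}` -/
  hA : 0 ≤ c.cA
  /-- `0 ≤ c_{B}` -/
  hB : 0 ≤ c.cB
  /-- `0 ≤ c_{AB}` -/
  hAB : 0 ≤ c.cAB
  /-- `0 ≤ c_{D}` -/
  hD : 0 ≤ c.cD
  /-- `0 ≤ c_{DA}` -/
  hDA : 0 ≤ c.cDA
  /-- `0 ≤ c_{AD}` -/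
  hAD : 0 ≤ c.cAD
  /-- `0 ≤ c_{DB}` -/
  hDB : 0 ≤ c.cDB
  /-- `0 ≤ c_{BD}` -/
  hBD : 0 ≤ c.cBD
  /-- `0 ≤ c_{ADB}` -/
  hADB : 0 ≤ c.cADB
  /-- `0 ≤ c_{BDA}` -/
  hBDA : 0 ≤ c.cBDA
  /-- `0 ≤ c_{BAD}` -/
  hBAD : 0 ≤ c.cBAD
  /-- `0 ≤ c_{DBA}` -/
  hDBA : 0 ≤ c.cDBA
  /-- `0 ≤ c_{DBAD}` -/
  hDBAD : 0 ≤ c.cDBAD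

/-- The strip vector of the empty strip: the identity operator. [folklore] -/
def one : S14 := ⟨1, 0, 0, 0, 0, 0, 0, 0, 0, 0, 0, 0, 0, 0⟩

/-- **Rim step on strip vectors**: `E_r · N = r·N + (1−r)·D·N`, with the left multiplication table of `D = detach`
(`D·I = D`, `D·A = DA`, `D·B = DB`, `D·AB = DBA`, `D·D = qD`, `D·DA = qDA`, `D·AD = D`, `D·DB = qDB`, `D·BD = D`, `D·ADB = DB`, `D·BDA = DA`,
`D·BAD = DBAD`, `D·DBA = qDBA`, `D·DBAD = qDBAD`). [folklore] -/
def stepE (q r : ℝ) (c : S14) : S14 :=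
  ⟨r * c.cI, r * c.cA, r * c.cB, r * c.cAB,
   r * c.cD + (1 - r) * (c.cI + q * c.cD + c.cAD + c.cBD),
   r * c.cDA + (1 - r) * (c.cA + q * c.cDA + c.cBDA),
   r * c.cAD,
   r * c.cDB + (1 - r) * (c.cB + q * c.cDB + c.cADB),
   r * c.cBD, r * c.cADB, r * c.cBDA, r * c.cBAD,
   r * c.cDBA + (1 - r) * (c.cAB + q * c.cDBA),
   r * c.cDBAD + (1 - r) * (c.cBAD + q * c.cDBAD)⟩

/-- **`a`-spoke on strip vectors**: `AC_x · N = (1−x)·N + x·A·N` (`A·I = A`, `A·B = AB`, `A·D = AD`, `A·DA = A`, `A·DB = ADB`, `A·BD = BAD`,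
`A·BDA = AB`, `A·DBA = AB`, `A·DBAD = BAD`, `A` fixes `A, AB, AD, ADB, BAD`). [folklore] -/
def stepA (x : ℝ) (c : S14) : S14 :=
  ⟨(1 - x) * c.cI, (1 - x) * c.cA + x * (c.cI + c.cA + c.cDA), (1 - x) * c.cB,
   (1 - x) * c.cAB + x * (c.cB + c.cAB + c.cBDA + c.cDBA),
   (1 - x) * c.cD, (1 - x) * c.cDA, (1 - x) * c.cAD + x * (c.cD + c.cAD), (1 - x) * c.cDB, (1 - x) * c.cBD,
   (1 - x) * c.cADB + x * (c.cDB + c.cADB), (1 - x) * c.cBDA,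
   (1 - x) * c.cBAD + x * (c.cBD + c.cBAD + c.cDBAD), (1 - x) * c.cDBA, (1 - x) * c.cDBAD⟩

/-- **`b`-spoke on strip vectors**: `BC_y · N = (1−y)·N + y·B·N` (the `a ↔ b` mirror of `stepA`). [folklore] -/
def stepB (y : ℝ) (c : S14) : S14 :=
  ⟨(1 - y) * c.cI, (1 - y) * c.cA, (1 - y) * c.cB + y * (c.cI + c.cB + c.cDB),
   (1 - y) * c.cAB + y * (c.cA + c.cAB + c.cADB + c.cDBA),
   (1 - y) * c.cD, (1 - y) * c.cDA, (1 - y) * c.cAD, (1 - y) * c.cDB, (1 - y) * c.cBD + y * (c.cD + c.cBD),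
   (1 - y) * c.cADB, (1 - y) * c.cBDA + y * (c.cDA + c.cBDA),
   (1 - y) * c.cBAD + y * (c.cAD + c.cBAD + c.cDBAD), (1 - y) * c.cDBA, (1 - y) * c.cDBAD⟩

/-- The kernel vector: the coefficients of the one linear relation among the 14 operators (`p = 1 − q`). [folklore] -/
def kerVec (q : ℝ) : S14 :=
  ⟨(1 - q) * (2 - q), -(1 - q) ^ 2, -(1 - q) ^ 2, q ^ 2, 1 - q, -(1 - q), -(1 - q), -(1 - q), -(1 - q), 1 - q, 1 - q, -q, -q, 1⟩

/-- `stepE` preserves non-negativity (`0 ≤ q`, `r ∈ [0,1]`). [folklore] -/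
theorem Nonneg.stepE {q r : ℝ} (hq : 0 ≤ q) (hr0 : 0 ≤ r) (hr1 : r ≤ 1) {c : S14} (h : c.Nonneg) : (c.stepE q r).Nonneg := by
  obtain ⟨_, _, _, _, _, _, _, _, _, _, _, _, _, _⟩ := h
  have hr' : 0 ≤ 1 - r := sub_nonneg.2 hr1
  refine ⟨?_, ?_, ?_, ?_, ?_, ?_, ?_, ?_, ?_, ?_, ?_, ?_, ?_, ?_⟩ <;> simp only [S14.stepE] <;> positivity

/-- `stepA` preserves non-negativity (`x ∈ [0,1]`). [folklore] -/
theorem Nonneg.stepA {x : ℝ} (hx0 : 0 ≤ x) (hx1 : x ≤ 1) {c : S14} (h : c.Nonneg) : (c.stepA x).Nonneg := by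
  obtain ⟨_, _, _, _, _, _, _, _, _, _, _, _, _, _⟩ := h
  have hx' : 0 ≤ 1 - x := sub_nonneg.2 hx1
  refine ⟨?_, ?_, ?_, ?_, ?_, ?_, ?_, ?_, ?_, ?_, ?_, ?_, ?_, ?_⟩ <;> simp only [S14.stepA] <;> positivity

/-- `stepB` preserves non-negativity (`y ∈ [0,1]`). [folklore] -/
theorem Nonneg.stepB {y : ℝ} (hy0 : 0 ≤ y) (hy1 : y ≤ 1) {c : S14} (h : c.Nonneg) : (c.stepB y).Nonneg := by
  obtain ⟨_, _, _, _, _, _, _, _, _, _, _, _, _, _⟩ := h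
  have hy' : 0 ≤ 1 - y := sub_nonneg.2 hy1
  refine ⟨?_, ?_, ?_, ?_, ?_, ?_, ?_, ?_, ?_, ?_, ?_, ?_, ?_, ?_⟩ <;> simp only [S14.stepB] <;> positivity

/-- The empty strip vector is non-negative. [folklore] -/
theorem one_nonneg : one.Nonneg := by
  refine ⟨?_, ?_, ?_, ?_, ?_, ?_, ?_, ?_, ?_, ?_, ?_, ?_, ?_, ?_⟩ <;> simp [one]

end S14

/-- **The strip combination**: the 14 planar monoid operators `W_m ∈ ⟨detach, P_a, P_b⟩` applied to `X`, weighted by the coefficients `c`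
(`P_a X = AC_1 ∗ X`, `P_b X = BC_1 ∗ X`; the word `m` is read as a composition, e.g. `W_{DBA} X = detach (P_b (P_a X))`). [folklore] -/
def stripCombo (q : ℝ) (c : S14) (X : V5) : V5 :=
  ⟨c.cI * X.z0 +
    c.cA * (opA X).z0 +
    c.cB * (opB X).z0 +
    c.cAB * (opA (opB X)).z0 +
    c.cD * (detach q X).z0 +
    c.cDA * (detach q (opA X)).z0 +
    c.cAD * (opA (detach q X)).z0 +
    c.cDB * (detach q (opB X)).z0 +
    c.cBD * (opB (detach q X)).z0 +
    c.cADB * (opA (detach q (opB X))).z0 +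
    c.cBDA * (opB (detach q (opA X))).z0 +
    c.cBAD * (opB (opA (detach q X))).z0 +
    c.cDBA * (detach q (opB (opA X))).z0 +
    c.cDBAD * (detach q (opB (opA (detach q X)))).z0,
   c.cI * X.zab +
    c.cA * (opA X).zab +
    c.cB * (opB X).zab +
    c.cAB * (opA (opB X)).zab +
    c.cD * (detach q X).zab +
    c.cDA * (detach q (opA X)).zab +
    c.cAD * (opA (detach q X)).zab +
    c.cDB * (detach q (opB X)).zab +
    c.cBD * (opB (detach q X)).zab +
    c.cADB * (opA (detach q (opB X))).zab +
    c.cBDA * (opB (detach q (opA X))).zab +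
    c.cBAD * (opB (opA (detach q X))).zab +
    c.cDBA * (detach q (opB (opA X))).zab +
    c.cDBAD * (detach q (opB (opA (detach q X)))).zab,
   c.cI * X.zac +
    c.cA * (opA X).zac +
    c.cB * (opB X).zac +
    c.cAB * (opA (opB X)).zac +
    c.cD * (detach q X).zac +
    c.cDA * (detach q (opA X)).zac +
    c.cAD * (opA (detach q X)).zac +
    c.cDB * (detach q (opB X)).zac +
    c.cBD * (opB (detach q X)).zac +
    c.cADB * (opA (detach q (opB X))).zac +
    c.cBDA * (opB (detach q (opA X))).zac +
    c.cBAD * (opB (opA (detach q X))).zac +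
    c.cDBA * (detach q (opB (opA X))).zac +
    c.cDBAD * (detach q (opB (opA (detach q X)))).zac,
   c.cI * X.zbc +
    c.cA * (opA X).zbc +
    c.cB * (opB X).zbc +
    c.cAB * (opA (opB X)).zbc +
    c.cD * (detach q X).zbc +
    c.cDA * (detach q (opA X)).zbc +
    c.cAD * (opA (detach q X)).zbc +
    c.cDB * (detach q (opB X)).zbc +
    c.cBD * (opB (detach q X)).zbc +
    c.cADB * (opA (detach q (opB X))).zbc +
    c.cBDA * (opB (detach q (opA X))).zbc +
    c.cBAD * (opB (opA (detach q X))).zbc +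
    c.cDBA * (detach q (opB (opA X))).zbc +
    c.cDBAD * (detach q (opB (opA (detach q X)))).zbc,
   c.cI * X.z1 +
    c.cA * (opA X).z1 +
    c.cB * (opB X).z1 +
    c.cAB * (opA (opB X)).z1 +
    c.cD * (detach q X).z1 +
    c.cDA * (detach q (opA X)).z1 +
    c.cAD * (opA (detach q X)).z1 +
    c.cDB * (detach q (opB X)).z1 +
    c.cBD * (opB (detach q X)).z1 +
    c.cADB * (opA (detach q (opB X))).z1 +
    c.cBDA * (opB (detach q (opA X))).z1 +
    c.cBAD * (opB (opA (detach q X))).z1 +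
    c.cDBA * (detach q (opB (opA X))).z1 +
    c.cDBAD * (detach q (opB (opA (detach q X)))).z1⟩

/-- The empty strip acts as the identity. [folklore] -/
theorem stripCombo_one (q : ℝ) (X : V5) : stripCombo q S14.one X = X := by
  ext <;> simp [stripCombo, S14.one]

/-- **Rim step**: `E_r (Σ c_m W_m X) = Σ (stepE c)_m W_m X` (uses `D² = qD`, `DAD = DBD = D`, `D·ADB = DB`, `D·BDA = DA`, `D·BAD = DBAD`). [folklore] -/
theorem rimStep_stripCombo (q r : ℝ) (c : S14) (X : V5) : rimStep q r (stripCombo q c X) = stripCombo q (c.stepE q r) X := by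
  ext <;> simp only [rimStep, stripCombo, S14.stepE, opA, opB, conv, edgeAC, edgeBC, detach, V5.total] <;> ring

/-- **`a`-spoke**: `AC_x ∗ (Σ c_m W_m X) = Σ (stepA c)_m W_m X` (uses `A² = A`, `ADA = A`, `A·BDA = A·DBA = AB`, `A·DBAD = BAD`). [folklore] -/
theorem conv_edgeAC_stripCombo (q x : ℝ) (c : S14) (X : V5) : conv (edgeAC x) (stripCombo q c X) = stripCombo q (c.stepA x) X := by
  ext <;> simp only [stripCombo, S14.stepA, opA, opB, conv, edgeAC, edgeBC, detach, V5.total] <;> ring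

/-- **`b`-spoke**: `BC_y ∗ (Σ c_m W_m X) = Σ (stepB c)_m W_m X` (uses `B² = B`, `BDB = B`, `B·ADB = B·DBA = AB`, `B·DBAD = BAD`). [folklore] -/
theorem conv_edgeBC_stripCombo (q y : ℝ) (c : S14) (X : V5) : conv (edgeBC y) (stripCombo q c X) = stripCombo q (c.stepB y) X := by
  ext <;> simp only [stripCombo, S14.stepB, opA, opB, conv, edgeAC, edgeBC, detach, V5.total] <;> ring

/-- **The linear relation**: `Σ_m (kerVec q)_m · W_m = 0` — the 14 planar monoid operators span only the 13-dimensional block algebra. [folklore] -/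
theorem stripCombo_kerVec (q : ℝ) (X : V5) : stripCombo q (S14.kerVec q) X = ⟨0, 0, 0, 0, 0⟩ := by
  ext <;> simp only [stripCombo, S14.kerVec, opA, opB, conv, edgeAC, edgeBC, detach, V5.total] <;> ring

/-- **The "forget `c_j`" reduction in closed form**: `Σ_m c_m W_m δ₀` is the three-terminal vector of the strip read from `c_j` (a closed-off
singleton `c_j` carries the factor `q`): `(I + qD + DA + DB, DBA + q·DBAD, A + q·AD + ADB, B + q·BD + BDA, AB + q·BAD)`. [folklore] -/
theorem stripCombo_delta0 (q : ℝ) (c : S14) :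
    stripCombo q c delta0 = ⟨c.cI + q * c.cD + c.cDA + c.cDB, c.cDBA + q * c.cDBAD, c.cA + q * c.cAD + c.cADB,
      c.cB + q * c.cBD + c.cBDA, c.cAB + q * c.cBAD⟩ := by
  ext <;> simp only [stripCombo, delta0, opA, opB, conv, edgeAC, edgeBC, detach, V5.total] <;> ring

/-! ### The strip vector of a middle and the reduction of the middle word -/

/-- **The strip vector of a middle**: starting from `c`, each block `(r, x, y)` acts by `stepE r`, then `stepB y`, then `stepA x`
(the order of `midWord`: rim step, `b`-spoke, `a`-spoke). [folklore] -/
def stripVec (q : ℝ) : List (ℝ × ℝ × ℝ) → S14 → S14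
  | [], c => c
  | blk :: rest, c => stripVec q rest (((c.stepE q blk.1).stepB blk.2.2).stepA blk.2.1)

/-- **The middle word through the strip vector**, for every starting combination. [folklore] -/
theorem midWord_stripCombo (q : ℝ) :
    ∀ (mids : List (ℝ × ℝ × ℝ)) (c : S14) (X : V5), midWord q mids (stripCombo q c X) = stripCombo q (stripVec q mids c) X := by
  intro mids
  induction mids with
  | nil => intro c X; simp [midWord, stripVec]
  | cons blk rest ih =>
    intro c X
    simp only [midWord, stripVec, rimStep_stripCombo, conv_edgeBC_stripCombo, conv_edgeAC_stripCombo]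
    exact ih _ X

/-- **Every middle word is a strip combination**: `midWord q mids X = Σ_m (stripVec q mids 1)_m · W_m X`. [folklore] -/
theorem midWord_eq_stripCombo (q : ℝ) (mids : List (ℝ × ℝ × ℝ)) (X : V5) :
    midWord q mids X = stripCombo q (stripVec q mids S14.one) X := by
  rw [← midWord_stripCombo q mids S14.one X, stripCombo_one]

/-- Strip vectors of middles with weights in `[0,1]` are non-negative (`0 ≤ q`). [folklore] -/
theorem stripVec_nonneg {q : ℝ} (hq : 0 ≤ q) :
    ∀ {mids : List (ℝ × ℝ × ℝ)}, UnitBlocks mids → ∀ {c : S14}, c.Nonneg → (stripVec q mids c).Nonneg := by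
  intro mids
  induction mids with
  | nil => intro _ c hc; simpa [stripVec] using hc
  | cons blk rest ih =>
    intro hm c hc
    have hb := hm blk (by simp)
    have hrest : UnitBlocks rest := fun b hb' => hm b (by simp [hb'])
    simp only [stripVec]
    exact ih hrest (((hc.stepE hq hb.1 hb.2.1).stepB hb.2.2.2.2.1 hb.2.2.2.2.2).stepA hb.2.2.1 hb.2.2.2.1)

/-! ### The pinned partition functions as linear functionals of the strip vector -/

/-- **The pinned partition functions of the cross-apex pair through a strip vector**:
`stripZ q c u s σ τ = val_q(s ∗ BC_τ ∗ Σ_m c_m W_m (AC_σ ∗ u))` — linear in `c`. [folklore] -/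
def stripZ (q : ℝ) (c : S14) (u s : V5) (σ τ : ℝ) : ℝ :=
  val q (conv s (conv (edgeBC τ) (stripCombo q c (conv (edgeAC σ) u))))

/-- The strip vectors of genuine middles: `stripVec` of unit blocks followed by the last rim step `rd ∈ [0,1]`. [folklore] -/
def IsStripVec (q : ℝ) (c : S14) : Prop :=
  ∃ mids : List (ℝ × ℝ × ℝ), ∃ rd : ℝ, UnitBlocks mids ∧ 0 ≤ rd ∧ rd ≤ 1 ∧ c = (stripVec q mids S14.one).stepE q rd

/-- Genuine strip vectors are non-negative (`0 ≤ q`). [folklore] -/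
theorem IsStripVec.nonneg {q : ℝ} (hq : 0 ≤ q) {c : S14} (h : IsStripVec q c) : c.Nonneg := by
  obtain ⟨mids, rd, hm, hrd0, hrd1, rfl⟩ := h
  exact (stripVec_nonneg hq hm S14.one_nonneg).stepE hq hrd0 hrd1

/-- **`crossFarZ` through the strip vector**: `crossFarZ q mids rd u s σ τ = stripZ q ((stripVec q mids 1).stepE q rd) u s σ τ`. [folklore] -/
theorem crossFarZ_eq_stripZ (q : ℝ) (mids : List (ℝ × ℝ × ℝ)) (rd : ℝ) (u s : V5) (σ τ : ℝ) :
    crossFarZ q mids rd u s σ τ = stripZ q ((stripVec q mids S14.one).stepE q rd) u s σ τ := by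
  simp only [crossFarZ, stripZ, midWord_eq_stripCombo, rimStep_stripCombo]

/-- Middle words with weights in `[0,1]` preserve `InKE q`. [folklore] -/
theorem InKE.midWord {q : ℝ} : ∀ {mids : List (ℝ × ℝ × ℝ)}, UnitBlocks mids → ∀ {X : V5}, InKE q X → InKE q (midWord q mids X) := by
  intro mids
  induction mids with
  | nil => intro _ X hX; simpa [ThreeApex.midWord] using hX
  | cons blk rest ih =>
    intro hm X hX
    have hb := hm blk (by simp)
    have hrest : UnitBlocks rest := fun b hb' => hm b (by simp [hb'])
    simp only [ThreeApex.midWord]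
    exact ih hrest (InKE.step (IsLetter.ac hb.2.2.1 hb.2.2.2.1)
      (InKE.step (IsLetter.bc hb.2.2.2.2.1 hb.2.2.2.2.2) (InKE.rim hb.1 hb.2.1 hX)))

/-- **The "forget `c_j`" reduction of a genuine strip vector is an `InKE` vector**: it is the middle word (and last rim step) applied to `δ₀`. [folklore] -/
theorem isStripVec_forget_inKE {q : ℝ} {c : S14} (h : IsStripVec q c) : InKE q (stripCombo q c delta0) := by
  obtain ⟨mids, rd, hm, hrd0, hrd1, rfl⟩ := h
  rw [← rimStep_stripCombo, ← midWord_eq_stripCombo]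
  exact InKE.rim hrd0 hrd1 (InKE.midWord hm InKE.base)

open MeasureTheory Literature.Probability.LatticeModels Literature.Probability.Percolation
open scoped Classical

variable {V : Type*} [Fintype V]

section Setting

variable {a b : V} {c : ℕ → V} {m : ℕ}
variable (hab : a ≠ b) (hinj : ∀ j k, j ≤ m → k ≤ m → c j = c k → j = k) (hca : ∀ j, j ≤ m → c j ≠ a) (hcb : ∀ j, j ≤ m → c j ≠ b)
include hab hinj hca hcb

/-- **THE FINITE-DIMENSIONAL REDUCTION OF THE TWO-SIDED PROBLEM.**  If the quadratic form
`c ↦ stripZ¹⁰·stripZ⁰¹ − stripZ¹¹·stripZ⁰⁰` is non-negative at every genuine strip vector `c` (a subset of the 13-dimensional variety of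
memo §2) for all `u, s ∈ InKE q`, then in every weighted double fan every cross-apex pair `(a c_j, b c_k)`, `j < k`, is negatively
correlated — at EVERY distance and for EVERY (two-sided) middle. [folklore] -/
theorem negCorr_spokes_cross_far_of_strip (hcard : Fintype.card V = m + 3) {q : ℝ} (hq0 : 0 < q) (w : Sym2 V → unitInterval)
    (hsupp : ∀ e, e ∉ dfPairs a b c m → w e = 0)
    (hstrip : ∀ cs : S14, IsStripVec q cs → ∀ u s : V5, InKE q u → InKE q s →
      0 ≤ stripZ q cs u s 1 0 * stripZ q cs u s 0 1 - stripZ q cs u s 1 1 * stripZ q cs u s 0 0)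
    {j k : ℕ} (hjk : j < k) (hk : k ≤ m) :
    (rcMeasureW w q ∅).real ({ω : BondConfig V | s(a, c j) ∈ ω} ∩ {ω | s(b, c k) ∈ ω}) ≤
      (rcMeasureW w q ∅).real {ω : BondConfig V | s(a, c j) ∈ ω} * (rcMeasureW w q ∅).real {ω : BondConfig V | s(b, c k) ∈ ω} := by
  refine negCorr_spokes_cross_far_of_inKE hab hinj hca hcb hcard hq0 w hsupp ?_ hjk hk
  intro mids hm rd hrd0 hrd1 u s hu hs
  simpa only [crossFarZ_eq_stripZ] using hstrip _ ⟨mids, rd, hm, hrd0, hrd1, rfl⟩ u s hu hs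

end Setting

end ThreeApex

end FK

end Summit.CriticalPhenomena.PercolationContinuityZ3.Theorems
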